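import Summits.HodgeConjecture.HodgeConjecture.Statement
import Literature.Geometry.Kaehler.SmoothHermitianBundleChernCharacter

/-!
# Birth skeleton (BC3) of the piece `HodgeClassesFromApproxHYM` (FLEXIBILITY, span form)

Crux-strategist `cstrat-stmt-HodgeConjecture-3025`, BC2-redirect of the deciding crux
`HodgeClassesConiveauOne` of route `HolomorphicDefect`.  Two registered stubs and the kernel-checked
composition; `sorry` only inside `stub_*`.

* `stub_hodgeChernCharacterCarriers` — K-THEORETIC CARRIERS (Atiyah–Hirzebruch + Chern–Weil): on a Hodge
  model `A` of a smooth projective `X`, every rational `(p,p)`-class, `p ≥ 1`, pulls back into the `ℂ`-span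
  of the `p`-th Chern characters of the `C^∞` Hermitian bundles `G` on `X^an` whose whole Chern character is
  Hodge (`ch_k(G) ∈ H^{k,k}`, `k ≥ 1`).  KNOWN in print: `ch ⊗ ℚ : K⁰(X^an) ⊗ ℚ ≅ H^{ev}(X^an; ℚ)`
  (Atiyah–Hirzebruch 1961, §2; Karoubi, K-theory V.3.25) gives a virtual class `ξ` with `ch(ξ) = N • c`
  concentrated in degree `2p`; `ξ + [ℂ^m] = [G]` for a genuine bundle `G` (every class of `K⁰` of a compact
  space is `[G] - [ℂ^m]`), whose Chern character `m + N • c` is Hodge in every degree; any Hermitian metric;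
  the Chern–Weil class is the topological one (Kobayashi II Thm. 2.16, in the tree: `chernCharacter_eq`).
  Unformalised (no topological K-theory / Atiyah–Hirzebruch in Mathlib): size L.
* `stub_approxHYMGeneration` — APPROXIMATE-HYM GENERATION (the h-principle heart of the card's flexibility
  half): on a Hodge model of a smooth projective `X`, for `p ≥ 1`, the `ℂ`-span of the `ch_p(G)`, `G` with
  Hodge Chern character, is contained in the `ℂ`-span of the `ch_p(G)` of those `G` that are moreover
  approximately Hermitian–Yang–Mills for some smooth (necessarily Kähler) metric.  HC-implied (Mistretta 2006
  Cor. 3.3: `CH*(X)_ℚ` is generated by Chern characters of `μ`-stable bundles; Uhlenbeck–Yau 1986: stable ⇒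
  Hermitian–Einstein ⇒ `δ = 0`; Voisin I Thm. 11.32); an HC-free proof would deform the Hermitian
  structure/connection of `G ⊕ ℂ^N ⊗ H^m` to make `δ_g` arbitrarily small (semistable ⟺ approximate
  Hermitian–Einstein: Kobayashi VI.10.13, Jacob 2014, is the holomorphic prototype).  OPEN; the piece's risk
  (an `L²`-gap `inf δ ≥ γ > 0` on every carrier of some Hodge class) sits exactly here.
* `HodgeClassesFromApproxHYM_of_stubs` (no `sorry`): containment of spans.

The piece is restated here VERBATIM as a local `def` (self-contained version: it imports only the Statement cone and
Literature, so it elaborates independently of the route module's olean); the BY-NAME version concluding the route decl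
is attached as evidence on stmt-HodgeConjecture-3025 (out/HodgeClassesFromApproxHYM-birth.lean) for registration with `ledger skeleton check --crux <piece item>`.
-/

open scoped Manifold ContDiff

namespace Summit.HodgeConjecture.HodgeConjecture.Cruxes.HodgeClassesFromApproxHYM.Birth

open Literature.AlgebraicGeometry.Motives Literature.AlgebraicGeometry.HodgeTheory
  Literature.AlgebraicTopology.SingularHomology Literature.Geometry.Kaehler

/-- The piece (FLEXIBILITY, span form; the restated item `HodgeClassesFromApproxHYM`), verbatim. -/
def HodgeClassesFromApproxHYM : Prop :=
  ∀ ⦃n : ℕ⦄ ⦃X : Literature.AlgebraicGeometry.Motives.SchemeOver ℂ⦄, Literature.AlgebraicGeometry.Motives.IsSmoothProjective n X → ∀ (A : Literature.AlgebraicGeometry.HodgeTheory.HodgeModel n X) (p : ℕ) (c : Literature.AlgebraicTopology.SingularHomology.singularCohomology ℂ ℂ (Literature.AlgebraicGeometry.Motives.ComplexPoints X) (2 * p)), 1 ≤ p → Literature.AlgebraicGeometry.HodgeTheory.IsRationalClass c → A.pullback (2 * p) c ∈ A.hodgePQ (2 * p) p p → A.pullback (2 * p) c ∈ Submodule.span ℂ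 {γ | ∃ (G : Literature.Geometry.Kaehler.SmoothHermitianBundle A.model A.carrier) (g : Bundle.ContMDiffRiemannianMetric 𝓘(ℝ, A.model) (⊤ : ℕ∞) A.model (fun x : A.carrier ↦ TangentSpace 𝓘(ℝ, A.model) x)), G.IsApproxHermitianYangMills g ∧ (∀ k : ℕ, 1 ≤ k → G.chernCharacter A.deRham k ∈ A.hodgePQ (2 * k) k k) ∧ γ = G.chernCharacter A.deRham p}

/-- **Stub F1 — K-theoretic carriers with Hodge Chern character** (Atiyah–Hirzebruch). See the module
docstring. [AtiyahHirzebruch1961 §2; Kobayashi1987 II Thm. 2.16] -/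
theorem stub_hodgeChernCharacterCarriers :
    ∀ ⦃n : ℕ⦄ ⦃X : SchemeOver ℂ⦄, IsSmoothProjective n X →
      ∀ (A : HodgeModel n X) (p : ℕ) (c : complexBetti X (2 * p)), 1 ≤ p → IsRationalClass c →
        A.pullback (2 * p) c ∈ A.hodgePQ (2 * p) p p →
          A.pullback (2 * p) c ∈ Submodule.span ℂ
            {γ | ∃ G : SmoothHermitianBundle A.model A.carrier,
              (∀ k : ℕ, 1 ≤ k → G.chernCharacter A.deRham k ∈ A.hodgePQ (2 * k) k k) ∧
                γ = G.chernCharacter A.deRham p} := by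
  sorry

/-- **Stub F2 — approximate-HYM generation** (the flexibility heart). See the module docstring.
[Mistretta2006 Cor. 3.3; UhlenbeckYau1986; Kobayashi1987 VI.10.13; Jacob2014] -/
theorem stub_approxHYMGeneration :
    ∀ ⦃n : ℕ⦄ ⦃X : SchemeOver ℂ⦄, IsSmoothProjective n X →
      ∀ (A : HodgeModel n X) (p : ℕ), 1 ≤ p →
        Submodule.span ℂ
            {γ | ∃ G : SmoothHermitianBundle A.model A.carrier,
              (∀ k : ℕ, 1 ≤ k → G.chernCharacter A.deRham k ∈ A.hodgePQ (2 * k) k k) ∧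
                γ = G.chernCharacter A.deRham p} ≤
          Submodule.span ℂ
            {γ | ∃ (G : SmoothHermitianBundle A.model A.carrier)
              (g : Bundle.ContMDiffRiemannianMetric 𝓘(ℝ, A.model) (⊤ : ℕ∞) A.model
                (fun x : A.carrier ↦ TangentSpace 𝓘(ℝ, A.model) x)),
              G.IsApproxHermitianYangMills g ∧
                (∀ k : ℕ, 1 ≤ k → G.chernCharacter A.deRham k ∈ A.hodgePQ (2 * k) k k) ∧
                  γ = G.chernCharacter A.deRham p} := by
  sorry

/-- **Composition, implication form** (kernel-checked, no `sorry`). -/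
theorem HodgeClassesFromApproxHYM_of_stubs
    (h1 : ∀ ⦃n : ℕ⦄ ⦃X : SchemeOver ℂ⦄, IsSmoothProjective n X →
      ∀ (A : HodgeModel n X) (p : ℕ) (c : complexBetti X (2 * p)), 1 ≤ p → IsRationalClass c →
        A.pullback (2 * p) c ∈ A.hodgePQ (2 * p) p p →
          A.pullback (2 * p) c ∈ Submodule.span ℂ
            {γ | ∃ G : SmoothHermitianBundle A.model A.carrier,
              (∀ k : ℕ, 1 ≤ k → G.chernCharacter A.deRham k ∈ A.hodgePQ (2 * k) k k) ∧
                γ = G.chernCharacter A.deRham p})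
    (h2 : ∀ ⦃n : ℕ⦄ ⦃X : SchemeOver ℂ⦄, IsSmoothProjective n X →
      ∀ (A : HodgeModel n X) (p : ℕ), 1 ≤ p →
        Submodule.span ℂ
            {γ | ∃ G : SmoothHermitianBundle A.model A.carrier,
              (∀ k : ℕ, 1 ≤ k → G.chernCharacter A.deRham k ∈ A.hodgePQ (2 * k) k k) ∧
                γ = G.chernCharacter A.deRham p} ≤
          Submodule.span ℂ
            {γ | ∃ (G : SmoothHermitianBundle A.model A.carrier)
              (g : Bundle.ContMDiffRiemannianMetric 𝓘(ℝ, A.model) (⊤ : ℕ∞) A.model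
                (fun x : A.carrier ↦ TangentSpace 𝓘(ℝ, A.model) x)),
              G.IsApproxHermitianYangMills g ∧
                (∀ k : ℕ, 1 ≤ k → G.chernCharacter A.deRham k ∈ A.hodgePQ (2 * k) k k) ∧
                  γ = G.chernCharacter A.deRham p}) :
    HodgeClassesFromApproxHYM :=
  fun n X hX A p c hp hr hh ↦ h2 hX A p hp (h1 hX A p c hp hr hh)

/-- **The piece from its registered stubs, by name** (no `sorry` of its own). -/
theorem HodgeClassesFromApproxHYM_of : HodgeClassesFromApproxHYM :=
  HodgeClassesFromApproxHYM_of_stubs stub_hodgeChernCharacterCarriers stub_approxHYMGeneration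

end Summit.HodgeConjecture.HodgeConjecture.Cruxes.HodgeClassesFromApproxHYM.Birth
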